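import Summits.BirchSwinnertonDyer.BirchSwinnertonDyer.Theorems.PrintX9MuPartStabilizedOfSpecWitnesses
import Literature.NumberTheory.EllipticCurves.HeegnerEnvelopeCoherentPairPrincipalProofs
import HarnessLib

/-!
# LP ⟹ L∃: the principal-system letter implies the coherent-pair letter (THE CUT v2's shared μ-item of
# rows 9/10), for the μ-letters AND for their witness shells (proofs file)

Cell `pub/bsd-print-x9`, seat `bsd-line-x9-p1-w2` (g4). THEOREMS ONLY; no definition, no named fact, no `sorry`;
ROUTE-INDEPENDENT (imports no `Theses` file). Namespace of the shared letters
(`Summit.BirchSwinnertonDyer.BirchSwinnertonDyer.Theorems.HeegnerMuPartStabilized`).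

WHAT.
* `muPartStabilizedCoherentPair_of_muPartStabilizedPrincipal : MuPartStabilizedPrincipal → MuPartStabilizedCoherentPair`
  — the principal-system letter LP (p630902) implies the coherent-pair letter L∃ (p630902; = the shared crux
  text `MuInequalityCoherentPair` of plan g10's THE CUT v2, by `Iff.rfl`): run the engine WITH ITS PRINCIPAL
  SYSTEM EXPORTED (`exists_coherent_pair_envelope_principal`, this seat's Literature file) and apply LP at the
  `(C, x, A)` it returns. With `muPartStabilizedPrincipal_of_print` / `muPartStabilizedCoherentPair_of_print`
  (trib-w-tld g9) the three letters are now ordered in the kernel: `∀C ⟹ LP ⟹ L∃`.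
* `specWitnessesCoherentPair_of_specWitnessesPrincipal : SpecWitnessesPrincipal → SpecWitnessesCoherentPair` —
  the same implication for the witness shells of `PrintX9MuPartSpecWitnessDefs` (p632362): a D1 port may
  prove the UNIVERSALLY quantified shell `SpecWitnessesPrincipal` (no `∃`, no engine inside its proof) and
  close the item through `muPartStabilizedCoherentPair_of_specWitnessesCoherentPair` (p633080).
HONEST FRAMING: neither LP nor any shell is proved anywhere (beyond citable print at `p ∣ h_K`, REF-118);
«beyond-print theorem»: no. BSD is not proved by any of this; no summit statement is proved by this seat.

References: [CastellaGrossiLeeSkinner2022] Rem. 4.1.4; [Howard2004HeegnerKolyvagin] §3.3, proof of Thm. 2.2.10.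
-/

set_option linter.dupNamespace false
set_option autoImplicit false

noncomputable section

open scoped Classical Pointwise

open Literature Literature.NumberTheory.EllipticCurves WeierstrassCurve

namespace Summit.BirchSwinnertonDyer.BirchSwinnertonDyer.Theorems.HeegnerMuPartStabilized

/-- **LP ⟹ L∃ (letters).** The principal-system μ-letter implies the coherent-pair μ-letter: the engine's
exported `(C, F)` on `(Dt, β)` is built on a principal system `x` with transversals `A`
(`exists_coherent_pair_envelope_principal`), so LP applies at that `C`.
[cite: CastellaGrossiLeeSkinner2022, Rem. 4.1.4 (arXiv:2008.02571v2 TeX L2278–2294)]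
[cite: Howard2004HeegnerKolyvagin, §3.3 and proof of Thm. 2.2.10] -/
theorem muPartStabilizedCoherentPair_of_muPartStabilizedPrincipal (h : MuPartStabilizedPrincipal) :
    MuPartStabilizedCoherentPair := by
  intro N _ W _ K _ _ p _ κ γ jbar hyp hCM hirr hirrK hsc hHp hhK hpN hTw1 hcardp Dt β hβ D X
  have hlev : N = W.conductorNorm ℤ := hyp.level
  subst hlev
  haveI : W.IsElliptic := hyp.isElliptic
  obtain ⟨C, F, x, A, hCDt, hFDt, hCβ, hFβ, hx, hfix, hA, hu, hv, hfwd, g, hg, hrev⟩ :=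
    exists_coherent_pair_envelope_principal (W := W) hyp.isImaginaryQuadratic hyp.heegner Dt hβ jbar
      hyp.ordinary hpN κ hyp.topGenerator hTw1 hcardp hyp.noPTorsion D
  refine ⟨C, F, hCDt, hFDt, hCβ, hFβ, hfwd, ⟨g, hg, hrev⟩, fun hfinS hfinX htor 𝔭 h𝔭 ↦ ?_⟩
  have hx' : ∀ j, complexPoint W jbar (x j) =
      ModularForms.heegnerPointComplexOfConductor C.Dt (NumberField.discr K) C.β (p ^ j) := by
    intro j
    rw [hCDt, hCβ]
    exact hx j
  exact h _ W K p κ γ jbar hyp hCM hirr hirrK hsc hHp hhK D C X x A hx' hfix hA hu hv hfinS hfinX htor 𝔭 h𝔭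

/-- **LP ⟹ L∃ (witness shells).** `SpecWitnessesPrincipal → SpecWitnessesCoherentPair`: the same engine run;
a port proving the universally quantified principal shell closes the shared item through
`muPartStabilizedCoherentPair_of_specWitnessesCoherentPair`.
[cite: CastellaGrossiLeeSkinner2022, Rem. 4.1.4 (arXiv:2008.02571v2 TeX L2278–2294)]
[cite: Howard2004HeegnerKolyvagin, §3.3 and proof of Thm. 2.2.10] -/
theorem specWitnessesCoherentPair_of_specWitnessesPrincipal (h : SpecWitnessesPrincipal) :
    SpecWitnessesCoherentPair := by
  intro N _ W _ K _ _ p _ κ γ jbar hyp hCM hirr hirrK hsc hHp hhK hpN hTw1 hcardp Dt β hβ D X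
  have hlev : N = W.conductorNorm ℤ := hyp.level
  subst hlev
  haveI : W.IsElliptic := hyp.isElliptic
  obtain ⟨C, F, x, A, hCDt, hFDt, hCβ, hFβ, hx, hfix, hA, hu, hv, hfwd, g, hg, hrev⟩ :=
    exists_coherent_pair_envelope_principal (W := W) hyp.isImaginaryQuadratic hyp.heegner Dt hβ jbar
      hyp.ordinary hpN κ hyp.topGenerator hTw1 hcardp hyp.noPTorsion D
  refine ⟨C, F, hCDt, hFDt, hCβ, hFβ, hfwd, ⟨g, hg, hrev⟩, fun hfinS hfinX htor ↦ ?_⟩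
  have hx' : ∀ j, complexPoint W jbar (x j) =
      ModularForms.heegnerPointComplexOfConductor C.Dt (NumberField.discr K) C.β (p ^ j) := by
    intro j
    rw [hCDt, hCβ]
    exact hx j
  exact h _ W K p κ γ jbar hyp hCM hirr hirrK hsc hHp hhK D C X x A hx' hfix hA hu hv hfinS hfinX htor

/-- **LP ⟹ the shared item through the witness road**: `SpecWitnessesPrincipal → MuPartStabilizedCoherentPair`
(composition with `muPartStabilizedCoherentPair_of_specWitnessesCoherentPair`, p633080).
[cite: Howard2004HeegnerKolyvagin, proof of Thm. 2.2.10 (𝔮 = T^m + p)] -/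
theorem muPartStabilizedCoherentPair_of_specWitnessesPrincipal (h : SpecWitnessesPrincipal) :
    MuPartStabilizedCoherentPair :=
  muPartStabilizedCoherentPair_of_specWitnessesCoherentPair (specWitnessesCoherentPair_of_specWitnessesPrincipal h)

end Summit.BirchSwinnertonDyer.BirchSwinnertonDyer.Theorems.HeegnerMuPartStabilized

end
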